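import Literature.Geometry.Lorentzian.HintzGluedEMRIData
import HarnessLib

/-!
# Hintz's gluing of a small black hole into Kerr initial data: the Kerr–Schild-slice existence
# theorem (family `gr`, summit `FinalStateConjecture`)

Companion of `HintzGluedEMRIData.lean` (which defines the vocabulary: coordinate readings,
blow-ups, `C^∞_loc` convergence, `Kerr.EmbeddedPatch`, `Kerr.BoostedFarPatch`,
`HintzGluing.IsGluedFamily`, `IsHintzGluedEMRIFamily`). This file vendors the one published
existence theorem for glued small-black-hole data on an EXACT Kerr background:

* P. Hintz, *Gluing small black holes into initial data sets*, Comm. Math. Phys. 405 (2024) 114 =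
  arXiv:2210.13960 [Hintz2022], **Theorem 6.2** (p. 66): let `(γ̂, k̂)` be `E`-asymptotically flat
  data on `ℝ³ ∖ K̂°` solving the vacuum constraints, and `(γ, k)` subextremal K((A)dS) data on the
  horizon-penetrating slice `X_{2η} = t⁻¹(0) ∩ {r > r_e − 2η}` (`t = t_BL − T(r)` with spacelike
  level sets transversal to `𝓗⁺`, `η > 0` small); let `p ∈ X₀` (the exterior) and `U° ⊂ X_{2η}` a
  smoothly bounded connected open set containing `p` with compact closure disjoint from
  `{r = r_e − 2η}` and with `U° ∩ (X_{2η} ∖ X_η) ≠ ∅`. "Then the conclusions of Theorem 5.2 hold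
  for `n = 3` and `X̃ = X̃_η`": a polyhomogeneous total family `(γ̃, k̃)` with boundary data
  `(γ̂, k̂)` and `(γ, k)`, equal to `(γ, k)` near `X̃ ∖ ([0,1) × U°)`, solving the constraints on
  every `ε`-level set of `X̃_η` for `ε < ε♯` (Thm. 5.2 (1)–(3), pp. 56–57); the cokernel (Kerr has
  KIDs) is disposed of by violating the constraints in `r < r_e − η`, below the slice `X_η`.
* Loc. cit. **Lemma 6.1** (p. 65): boosted Kerr initial data (induced on a hypersurface which is
  a level set of a boosted time `t_w` for large `r`, read in boosted Cartesian coordinates) are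
  `E`-asymptotically flat with `E = ℕ₀ + 1`; its proof — (1) the data at `t = 0` of any metric
  `−dt² + dx² + g′`, `g′ ∈ ρ C^∞_ext`, are `E`-asymptotically flat, (2) this class is Lorentz
  invariant — applies verbatim to the ingoing Kerr–Schild form `g = η + 2Hℓ ⊗ ℓ` of the tree
  (`KerrSchild.lean`: `H`, `ℓ` are `t*`-independent and smooth in `(1/|x|, x/|x|)` down to
  `1/|x| = 0`, `H = O(1/|x|)`), so the models `Kerr.BoostedFarPatch` of the companion file are
  admissible `(γ̂, k̂)` with `K̂ = ∅` when they solve the vacuum constraints on all of `ℝ³`.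

## Specialisation made here (each weaker than or equal to the printed statement)

* the slicing is the tree's ingoing Kerr–Schild one: `X_δ = Kerr.slice a (r₊ − δ)` with the
  induced data `Kerr.data` (`KerrData.lean`; `t* = t_BL − T(r)`, `φ* = φ − Φ(r)`, spacelike level
  sets transversal to `𝓗⁺` — an instance of Hintz's `(t, ϕ)`); `Λ = 0`, `n = 3`;
* `K̂ = ∅` and the model is boosted Kerr with a regular core (above), so every fibre is the whole
  slice `X_η`;
* the conclusions are recorded fibrewise (`Kerr.IsHintzGluedSliceFamily`): joint smoothness in
  `(ε, y)` for `ε > 0` (polyhomogeneous sections are smooth in the interior), the vacuum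
  constraints on `X_η`, equality with `Kerr.data` outside `U°`, `C^∞_loc` convergence to
  `Kerr.data` on `X_η ∖ {p}` and of the blow-ups at `p` (through an `h(p)`-orthonormal frame `L`,
  in place of geodesic normal coordinates) to `(γ̂, k̂)` on `ℝ³` — Thm. 1.1 (2)–(3) / (1.4);
* "smoothly bounded" is dropped from the hypotheses on `U°`: given any connected open `U° ∋ p`
  with compact closure in `X_{2η}` meeting the collar, a smoothly bounded connected open
  `U' ⊆ U°` containing `p` and a collar point exists (thicken a path), and equality outside `U'`
  implies equality outside `U°`;
* "for sufficiently small `η > 0`" is rendered as `∃ η₀ > 0, ∀ η ∈ (0, η₀)`.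

Nothing here is proved; the theorem is a named fact (D-0014) awaiting a (very large) discharge.
-/

noncomputable section

open Bundle Set Filter TopologicalSpace Manifold
open scoped Manifold ContDiff Topology

namespace Literature.Geometry.Lorentzian

/-! ### The Kerr-slice setting of Hintz's Theorem 6.2 and the existence fact -/

namespace Kerr

variable [Facts] [SliceFacts]

/-- **Hintz-glued family on a Kerr–Schild slice** (the conclusions of Hintz, arXiv:2210.13960,
Thm. 6.2 with Thm. 5.2 (1)–(3) and `K̂ = ∅`): background the induced Kerr data
`Kerr.data M a r₁ hM` on the horizon-penetrating slice `X_η = Kerr.slice a r₁`,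
`r₁ = r₊(M, a) − η`; gluing point `p`; gluing set `U` (Hintz's `U°`); model `D̂` on `E3`; frame
`L` at `p`; family `D ε` of data on `Kerr.slice a r₁` for `0 < ε < ε♯` such that: the family is
jointly smooth in `(ε, y)`; each member solves the vacuum constraint equations on the whole
slice `X_η` (violations live only in `r < r₁`, outside the slice); `D ε = Kerr data` at every
point of the slice outside `U`; `D ε → Kerr data` in `C^∞_loc(X_η ∖ {p})`; and the blow-ups at
`p` through `L` converge in `C^∞_loc(E3)` to `D̂` (factor `ε` on `k`).
[cite: Hintz2022, Thm. 6.2 and Thm. 5.2] -/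
structure IsHintzGluedSliceFamily (M a η : ℝ) (hM : 0 ≤ M) (p : E3) (U : Set E3)
    (Dhat : InitialDataSet (𝓡 3) E3) (L : E3 →L[ℝ] E3) (εs : ℝ)
    (D : ℝ → InitialDataSet 𝓘(ℝ, E3) (slice a (rPlus M a - η))) : Prop where
  /-- The parameter range `(0, ε♯)` is nonempty. -/
  εs_pos : 0 < εs
  /-- `(ε, y) ↦ h_ε(y)` is jointly smooth on `(0, ε♯) × X_η`. -/
  contDiffOn_h : ContDiffOn ℝ ∞ (fun q : ℝ × E3 ↦ (D q.1).coordHOn q.2)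
    (Ioo 0 εs ×ˢ (slice a (rPlus M a - η) : Set E3))
  /-- `(ε, y) ↦ k_ε(y)` is jointly smooth on `(0, ε♯) × X_η`. -/
  contDiffOn_k : ContDiffOn ℝ ∞ (fun q : ℝ × E3 ↦ (D q.1).coordKOn q.2)
    (Ioo 0 εs ×ˢ (slice a (rPlus M a - η) : Set E3))
  /-- Thm. 5.2 (3) on `X̃_η`: each member solves the vacuum constraints on the whole slice. -/
  isVacuumConstraintSolution : ∀ ε ∈ Ioo 0 εs, ∀ [(D ε).metric.HasLeviCivita],
    (D ε).IsVacuumConstraintSolution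
  /-- Thm. 5.2 (2): `D ε` is the Kerr slice datum at every point of the slice outside `U`. -/
  eq_of_not_mem : ∀ ε ∈ Ioo 0 εs, ∀ y : slice a (rPlus M a - η), (y : E3) ∉ U →
    (D ε).h.inner y = (data M a (rPlus M a - η) hM).h.inner y ∧
      (D ε).k y = (data M a (rPlus M a - η) hM).k y
  /-- Thm. 1.1 (2): `h_ε →` Kerr slice metric in `C^∞_loc(X_η ∖ {p})`. -/
  converges_h : HintzGluing.SmoothlyConvergesOn (fun ε ↦ (D ε).coordHOn)
    (data M a (rPlus M a - η) hM).coordHOn ((slice a (rPlus M a - η) : Set E3) \ {p})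
  /-- Thm. 1.1 (2): `k_ε →` Kerr slice second fundamental form in `C^∞_loc(X_η ∖ {p})`. -/
  converges_k : HintzGluing.SmoothlyConvergesOn (fun ε ↦ (D ε).coordKOn)
    (data M a (rPlus M a - η) hM).coordKOn ((slice a (rPlus M a - η) : Set E3) \ {p})
  /-- Thm. 1.1 (3): `h_ε(p + εLx̂)(L·, L·) → ĥ(x̂)` in `C^∞_loc(E3)`. -/
  blowup_h : HintzGluing.SmoothlyConvergesOn
    (fun ε ↦ HintzGluing.blowup (D ε).coordHOn p L ε) Dhat.coordH univ
  /-- Thm. 1.1 (3): `ε k_ε(p + εLx̂)(L·, L·) → k̂(x̂)` in `C^∞_loc(E3)`. -/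
  blowup_k : HintzGluing.SmoothlyConvergesOn
    (fun ε ↦ ε • HintzGluing.blowup (D ε).coordKOn p L ε) Dhat.coordK univ

/-- **Hintz's gluing of a small (boosted) Kerr black hole into Kerr initial data** — Hintz,
Comm. Math. Phys. 405 (2024) 114 = arXiv:2210.13960, **Theorem 6.2** (with the conclusions of
Theorem 5.2 and the asymptotic flatness Lemma 6.1 of the model), specialised to the ingoing
Kerr–Schild slicing of the tree and to models with a regular core (`K̂ = ∅`). For subextremal
`(M, a)` there is `η₀ > 0` such that for every `η ∈ (0, η₀)` (so that `dr` is timelike on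
`r₊ − 2η < r < r₊`), writing `r₁ = r₊ − η`, `r₂ = r₊ − 2η`: for every point `p` of the slice with
`r(p) > r₊` (the exterior `X₀`); every open connected `U ∋ p` with compact closure contained in
`X_{2η} = Kerr.slice a r₂` and meeting the collar `{r₂ < r ≤ r₁}` ("smoothly bounded" dropped,
w.l.o.g. by shrinking); every subextremal `(m̂, â)`, boost `Λ`, radius `R` and model datum `D̂`
on `E3` which solves the vacuum constraints and is boosted Kerr `(m̂, â, Λ)` outside the ball of
radius `R` (`Kerr.BoostedFarPatch`; such `D̂` is `E`-asymptotically flat with `E = ℕ₀ + 1` by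
the argument of Lemma 6.1: `g_{m̂,â} = η + 2Hℓ⊗ℓ` with `t*`-independent coefficients smooth in
`(1/|x|, x/|x|)`); and every frame `L` at `p` orthonormal for the Kerr slice metric
(`h_p(Lv, Lw) = ⟪v, w⟫`, the differential of normal coordinates), there exist `ε♯ > 0` and a
family `D ε` of data on `X_η = Kerr.slice a r₁` which is a Hintz-glued slice family
(`Kerr.IsHintzGluedSliceFamily`). Named fact (D-0014); theorem in print.
[cite: Hintz2022, Thm. 6.2, Thm. 5.2, Lemma 6.1] -/
def hintz2022_kerrSliceGluing : Prop :=
  ∀ (M a : ℝ) (hMa : IsSubextremal M a), ∃ η₀ : ℝ, 0 < η₀ ∧ ∀ η ∈ Ioo 0 η₀,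
    ∀ (p : E3) (hp : p ∈ slice a (rPlus M a - η)),
      rPlus M a < radius a (E4.ofTimeSpace 0 p) →
    ∀ U : Set E3, IsOpen U → IsConnected U → p ∈ U → IsCompact (closure U) →
      closure U ⊆ (slice a (rPlus M a - 2 * η) : Set E3) →
      (U ∩ {y | rPlus M a - 2 * η < radius a (E4.ofTimeSpace 0 y) ∧
        radius a (E4.ofTimeSpace 0 y) ≤ rPlus M a - η}).Nonempty →
    ∀ (m â rc R : ℝ) (hm : IsSubextremal m â) (Λ : lorentzGroup)
      (Dhat : InitialDataSet (𝓡 3) E3),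
      Nonempty (BoostedFarPatch m â rc hm.pos.le Λ R Dhat) →
      (∀ [Dhat.metric.HasLeviCivita], Dhat.IsVacuumConstraintSolution) →
    ∀ L : E3 →L[ℝ] E3,
      (∀ v w : E3, (data M a (rPlus M a - η) hMa.pos.le).h.inner ⟨p, hp⟩ (L v) (L w) =
        inner ℝ v w) →
    ∃ (εs : ℝ) (D : ℝ → InitialDataSet 𝓘(ℝ, E3) (slice a (rPlus M a - η))),
      IsHintzGluedSliceFamily M a η hMa.pos.le p U Dhat L εs D

end Kerr

end Literature.Geometry.Lorentzian

end
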